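import Mathlib.Analysis.Complex.ReImTopology
import Mathlib.Analysis.Calculus.Deriv.MeanValue
import Literature.NumberTheory.LFunctions.RieszCriterionNecessityProofs
import Literature.NumberTheory.LFunctions.HardyLittlewoodCriterionProofs
import HarnessLib

/-!
# RH-EQUIVALENT (PROVED AS AN EQUIVALENCE) · Hardy–Littlewood's criterion `HardyLittlewood1916_criterion`: the direction "RH ⟹ `Σ_{k≥1} (−x)^k/(k! ζ(2k+1)) = O(x^{−1/4+δ})`" PROVED by summation by parts against `g(x) = Σ_{n≤x} μ(n)/n ≪ x^{−1/2+ε}`; with the tree's "⟸" this DISCHARGES the named fact (`HardyLittlewood1916_criterion_holds`) — nothing here bears on the truth of RH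

Literature-typing tranche `rh-lit-broughan-2` (Broughan, *Equivalents of the Riemann Hypothesis*,
Vol. 2, Ch. 2 "Series Equivalents", §2.4 "The Series of Hardy and Littlewood", **Thm 2.5** =
Hardy–Littlewood's criterion). The typed named fact `HardyLittlewood1916_criterion` (file
`RieszTypeSeriesCriteria`) reads `RiemannHypothesis ↔ ∀ δ > 0, H = O(x^{−1/4+δ})` at `+∞`,
`H(x) = Σ_{k≥1} (−x)^k/(k! ζ(2k+1))` (`hardyLittlewoodFunction`). The file
`HardyLittlewoodCriterionProofs` PROVED "⟸" (`HardyLittlewood1916_criterion.mpr_holds`). This file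
PROVES "⟹" and assembles `theorem HardyLittlewood1916_criterion_holds : HardyLittlewood1916_criterion`
(D-0026 discharge; no new definition, no new fact).

## The argument (Hardy–Littlewood 1916 §2.5: "It is not difficult to prove that the result thus suggested is in fact true"; the summation-by-parts road of Báez-Duarte 2005)

By `H(x) = Σ_{n≥1} (μ(n)/n)(e^{−x/n²} − 1)` (tree: `hardyLittlewoodFunction_eq_tsum_moebius`) the
relevant partial sums are Littlewood's `g(N) = Σ_{n≤N} μ(n)/n` (Báez-Duarte 2005 [Möbius paper] §2
(2.2)–(2.3): "RH ⟺ `g(x) ≪ x^{−1/2+ε}`"; Hardy–Littlewood's criterion is his case `φ = β`, (3.7)).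
§1 PROVES `RH ⟹ |g(N)| ≤ C N^{−1/2+ε}` from the tree's Mertens dictionary (file
`LittlewoodCriterion`: the Abel transform `G(s) = Σ M(n+1)((n+1)^{−s} − (n+2)^{−s})` is holomorphic on
`Re s > θ` when `|M(n)| ≤ C n^θ` and `ζ G = 1` on `Re s > 1`): since `1/ζ(s) → 0` as `s → 1`
(tree: `MertensBoundRH.tendsto_inv_riemannZeta_one`) and `G` is continuous at `1`, **`G(1) = 0`**
(this encodes `Σ μ(n)/n = 0`), so Abel summation at `s = 1`,
`g(N) = M(N)/(N+1) + Σ_{n<N} M(n+1)(1/(n+1) − 1/(n+2)) = M(N)/(N+1) − Σ_{n≥N} term_n(1)`, gives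
`|g(N)| ≤ C N^{θ−1} + C Σ_{n≥N}(n+1)^{θ−2} ≤ C(1 + 1/(1−θ)) N^{θ−1}` (tail by the mean value
inequality `(m+1)^r ≤ (m^{r+1} − (m+1)^{r+1})/(−(r+1))`). §2–§3 then repeat the Riesz road: summation
by parts of `H(x) = Σ (e^{−x/n²} − 1)·(μ(n)/n)` against `g` (tree: `abs_tsum_mul_le_of_abel`), the
weight's derivative `e^{−x/t²}·2x/t³ = (2/t)·y e^{−y}` (`y = x/t²`) being `≤ 4 x^b t^{−1−2b}` for
`b = −1/4 + δ` (`y e^{−y} ≤ 2y^b`), so the series is dominated by `4C' x^b Σ n^{−1−δ}`.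

* §1 `MertensDictionary.G_one_eq_zero`, `rpow_succ_le_sub_div` (mean value inequality),
  `tsum_rpow_shift_le` (tail `Σ_{n≥N}(n+1)^r ≤ N^{r+1}/(−(r+1))`),
  `abs_sum_moebius_div_le_of_riemannHypothesis` (RH ⟹ `|Σ_{n≤N} μ(n)/n| ≤ C N^{−1/2+ε}`).
* §2 `mul_exp_neg_le_two_mul_rpow` (`y e^{−y} ≤ 2 y^b`, `−1 ≤ b ≤ 1`), `hasDerivAt_hlWeight`,
  `abs_hlWeight_sub_le`.
* §3 `hardyLittlewoodFunction_isBigO_of_riemannHypothesis`, `HardyLittlewood1916_criterion.mp_holds`,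
  **`HardyLittlewood1916_criterion_holds`**.

No new definitions, no new facts (D-0026); standard axioms only.

## References

* [HardyLittlewood1916] G. H. Hardy, J. E. Littlewood, *Contributions to the theory of the Riemann
  zeta-function and the theory of the distribution of primes*, Acta Math. 41 (1916/1918) 119–196,
  §2.5, p. 161, (2.545) (necessity: "It is not difficult to prove that the result thus suggested is
  in fact true").
* [Titchmarsh1986] E. C. Titchmarsh, *The Theory of the Riemann Zeta-Function*, 2nd ed., §14.25
  (Thm 14.25: under RH `Σ μ(n) n^{−s}` converges for `σ > 1/2` to `1/ζ(s)`), §14.32 (14.32.3).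
* [BaezDuarte2005Moebius] L. Báez-Duarte, *Möbius-convolutions and the Riemann hypothesis*, IJMMS
  2005:22 (arXiv:math/0504402), §2 (2.2)–(2.3) (`g(x) = Σ_{n≤x} μ(n)/n ≪ x^{−1/2+ε}` under RH), (3.7).
* [BaezDuarte2005] L. Báez-Duarte, IJMMS 2005:21 (arXiv:math/0307215), §3 (summation by parts).
* [Broughan2017] K. Broughan, *Equivalents of the Riemann Hypothesis*, Vol. 2, Thm 2.5 (secondary; not held).
-/

noncomputable section

open Filter Asymptotics Finset Topology Complex

open scoped Real Nat

namespace Literature.NumberTheory.LFunctions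

/-! ## §1 Littlewood's `g(N) = Σ_{n≤N} μ(n)/n ≪ N^{−1/2+ε}` under RH -/

namespace MertensDictionary

variable {θ C : ℝ}

/-- **`G(1) = 0`**: the Abel transform `G(s) = Σ M(n+1)((n+1)^{−s} − (n+2)^{−s})` of `Σ μ(n)n^{−s}`,
holomorphic on `Re s > θ` (`θ < 1`) and equal to `1/ζ(s)` on `Re s > 1`, vanishes at the pole of `ζ`
(continuity at `1` and `1/ζ(s) → 0`); i.e. `Σ μ(n)/n = 0` in Abel-summed form (Titchmarsh Thm 14.25 (B):
the series represents `1/ζ(s)` for `σ > θ`). [cite: Titchmarsh1986, Thm 14.25 (B) (the sum function is 1/ζ(s) on σ > θ; at s = 1 this is 0)] -/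
theorem G_one_eq_zero
    (hC : ∀ n : ℕ, 1 ≤ n → |(LFunctions.mertensFunction (n : ℝ) : ℝ)| ≤ C * (n : ℝ) ^ θ)
    (hC0 : 0 ≤ C) (hθ : 0 ≤ θ) (hθ1 : θ < 1) : G 1 = 0 := by
  set S : Set ℂ := {s : ℂ | 1 < s.re} with hS
  -- continuity of `G` at `1`
  have hGd := differentiableOn_G hC hC0 hθ
  have h1mem : (1 : ℂ) ∈ {s : ℂ | θ < s.re} := by simp; linarith
  have hopen : IsOpen {s : ℂ | θ < s.re} := isOpen_lt continuous_const Complex.continuous_re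
  have hcont : ContinuousAt G 1 := (hGd.differentiableAt (hopen.mem_nhds h1mem)).continuousAt
  have hG : Tendsto G (𝓝[S] 1) (𝓝 (G 1)) := hcont.continuousWithinAt.tendsto
  -- `1/ζ → 0` along the same filter
  have hsub : S ⊆ {(1 : ℂ)}ᶜ := by
    intro s hs h1
    rw [Set.mem_singleton_iff] at h1
    rw [h1, hS, Set.mem_setOf_eq, one_re] at hs
    exact lt_irrefl _ hs
  have hζ : Tendsto (fun s ↦ (riemannZeta s)⁻¹) (𝓝[S] 1) (𝓝 0) :=
    MertensBoundRH.tendsto_inv_riemannZeta_one.mono_left (nhdsWithin_mono _ hsub)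
  -- `G = 1/ζ` on `S`
  have heq : (fun s ↦ (riemannZeta s)⁻¹) =ᶠ[𝓝[S] 1] G := by
    refine eventually_nhdsWithin_of_forall fun s hs ↦ ?_
    exact (eq_inv_of_mul_eq_one_right (riemannZeta_mul_G hC hC0 hθ hθ1 hs)).symm
  -- the filter is nontrivial: `1 ∈ closure S`
  have hcl : (1 : ℂ) ∈ closure S := by
    rw [hS, closure_setOf_lt_re]
    simp
  haveI : (𝓝[S] (1 : ℂ)).NeBot := mem_closure_iff_nhdsWithin_neBot.1 hcl
  exact tendsto_nhds_unique hG (hζ.congr' heq)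

end MertensDictionary

/-- Mean value inequality for `t ↦ t^{r+1}` (`r < −1`, `m > 0`):
`(m+1)^r ≤ (m^{r+1} − (m+1)^{r+1})/(−(r+1))`. [cite: Titchmarsh1986, §14.25 (partial summation, tail estimate)] -/
theorem rpow_succ_le_sub_div {m r : ℝ} (hm : 0 < m) (hr : r < -1) :
    (m + 1) ^ r ≤ (m ^ (r + 1) - (m + 1) ^ (r + 1)) / (-(r + 1)) := by
  have hr1 : 0 < -(r + 1) := by linarith
  have hcont : ContinuousOn (fun t : ℝ ↦ t ^ (r + 1)) (Set.Icc m (m + 1)) := fun t ht ↦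
    (Real.hasDerivAt_rpow_const (p := r + 1) (Or.inl (by linarith [ht.1] : t ≠ 0))).continuousAt
      |>.continuousWithinAt
  have hder : ∀ t ∈ Set.Ioo m (m + 1), HasDerivAt (fun t : ℝ ↦ t ^ (r + 1))
      ((r + 1) * t ^ (r + 1 - 1)) t := fun t ht ↦
    Real.hasDerivAt_rpow_const (Or.inl (by linarith [ht.1] : t ≠ 0))
  obtain ⟨ξ, hξ, hslope⟩ := exists_hasDerivAt_eq_slope (fun t : ℝ ↦ t ^ (r + 1))
    (fun t ↦ (r + 1) * t ^ (r + 1 - 1)) (by linarith : m < m + 1) hcont hder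
  rw [add_sub_cancel_right, show m + 1 - m = (1 : ℝ) by ring, div_one] at hslope
  -- `ξ^r ≥ (m+1)^r`
  have hξr : (m + 1) ^ r ≤ ξ ^ r :=
    Real.rpow_le_rpow_of_nonpos (by linarith [hξ.1]) hξ.2.le (by linarith)
  rw [le_div_iff₀ hr1]
  nlinarith

/-- Tail of the `p`-series by telescoping: for `N ≥ 1` and `r < −1`,
`Σ_{n≥0} (n+N+1)^r ≤ N^{r+1}/(−(r+1))`. [cite: Titchmarsh1986, §14.25 (partial summation, tail estimate)] -/
theorem tsum_rpow_shift_le {N : ℕ} (hN : 1 ≤ N) {r : ℝ} (hr : r < -1) :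
    ∑' n : ℕ, ((n : ℝ) + N + 1) ^ r ≤ (N : ℝ) ^ (r + 1) / (-(r + 1)) := by
  have hr1 : 0 < -(r + 1) := by linarith
  have hN0 : (0 : ℝ) < N := by exact_mod_cast hN
  set b : ℕ → ℝ := fun m ↦ ((m : ℝ) + N) ^ (r + 1) / (-(r + 1)) with hb
  have hb0 : ∀ m, 0 ≤ b m := fun m ↦ by positivity
  have hstep : ∀ m : ℕ, ((m : ℝ) + N + 1) ^ r ≤ b m - b (m + 1) := by
    intro m
    have h := rpow_succ_le_sub_div (m := (m : ℝ) + N) (by positivity) hr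
    simp only [hb, Nat.cast_add, Nat.cast_one]
    rw [show (m : ℝ) + 1 + N = (m : ℝ) + N + 1 by ring, ← sub_div]
    exact h
  refine Real.tsum_le_of_sum_range_le (fun n ↦ by positivity) fun L ↦ ?_
  have htel : ∑ i ∈ range L, (b i - b (i + 1)) = b 0 - b L := Finset.sum_range_sub' b L
  calc ∑ i ∈ range L, ((i : ℝ) + N + 1) ^ r ≤ ∑ i ∈ range L, (b i - b (i + 1)) :=
        Finset.sum_le_sum fun i _ ↦ hstep i
    _ = b 0 - b L := htel
    _ ≤ b 0 := by linarith [hb0 L]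
    _ = (N : ℝ) ^ (r + 1) / (-(r + 1)) := by simp [hb]

/-- **RH ⟹ `g(N) = Σ_{n≤N} μ(n)/n ≪ N^{−1/2+ε}`** (Littlewood; Titchmarsh Thm 14.25: under RH
`Σ μ(n)n^{−s}` converges for `σ > 1/2` with sum `1/ζ(s)`; Báez-Duarte 2005 (2.2)–(2.3)), PROVED from
the tree's `RH ⟹ |M(n)| ≤ C n^{1/2+ε}` by Abel summation at `s = 1` and `G(1) = 0`: for
`0 < ε < 1/2` there is `C'` with `|Σ_{j≤N} μ(j)/j| ≤ C' N^{−1/2+ε}` for all `N ≥ 1`.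
[cite: BaezDuarte2005Moebius, §2 (2.2)–(2.3); Titchmarsh1986 Thm 14.25 (B)–(C)] -/
theorem abs_sum_moebius_div_le_of_riemannHypothesis (hRH : RiemannHypothesis) {ε : ℝ} (hε : 0 < ε)
    (hε1 : ε < 1 / 2) :
    ∃ C' : ℝ, 0 ≤ C' ∧ ∀ N : ℕ, 1 ≤ N →
      |∑ j ∈ range (N + 1), ((ArithmeticFunction.moebius j : ℤ) : ℝ) / j| ≤
        C' * (N : ℝ) ^ (-(1 / 2 : ℝ) + ε) := by
  set θ : ℝ := 1 / 2 + ε with hθ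
  have hθ0 : 0 ≤ θ := by rw [hθ]; linarith
  have hθ1 : θ < 1 := by rw [hθ]; linarith
  obtain ⟨C, hC0, hC⟩ := MertensDictionary.exists_bound_of_isBigO (θ := θ) hθ0
    (mertensFunction_isBigO_of_riemannHypothesis hRH hε)
  have hG1 := MertensDictionary.G_one_eq_zero hC hC0 hθ0 hθ1
  refine ⟨C + C / (1 - θ), by positivity, fun N hN ↦ ?_⟩
  have hN0 : (0 : ℝ) < N := by exact_mod_cast hN
  -- Abel summation at `s = 1`
  have habel := MertensDictionary.sum_moebius_cpow_eq 1 N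
  have hsumm : Summable fun n ↦ MertensDictionary.term n 1 :=
    MertensDictionary.summable_term hC hθ0 (by simp; linarith)
  have htail : ∑ n ∈ range N, MertensDictionary.term n 1 =
      -∑' n : ℕ, MertensDictionary.term (n + N) 1 := by
    have h := hsumm.sum_add_tsum_nat_add N
    rw [show (∑' n, MertensDictionary.term n 1) = MertensDictionary.G 1 from rfl, hG1] at h
    linear_combination h
  -- the left side is the real sum `Σ_{n<N} μ(n+1)/(n+1)`
  have hreal : ∑ n ∈ range N, (ArithmeticFunction.moebius (n + 1) : ℂ) *
      ((n + 1 : ℕ) : ℂ) ^ (-(1 : ℂ)) =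
      ((∑ j ∈ range (N + 1), ((ArithmeticFunction.moebius j : ℤ) : ℝ) / j : ℝ) : ℂ) := by
    rw [Finset.sum_range_succ' (fun j ↦ ((ArithmeticFunction.moebius j : ℤ) : ℝ) / j)]
    simp only [Nat.cast_zero, div_zero, add_zero, cpow_neg_one]
    push_cast
    refine Finset.sum_congr rfl fun n _ ↦ ?_
    rw [div_eq_mul_inv]
  -- tail bound
  have htailb : ‖∑' n : ℕ, MertensDictionary.term (n + N) 1‖ ≤ C / (1 - θ) * (N : ℝ) ^ (θ - 1) := by
    have hnle : ∀ n : ℕ, ‖MertensDictionary.term (n + N) 1‖ ≤ C * (((n : ℝ) + N + 1) ^ (θ - 2)) := by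
      intro n
      have h := MertensDictionary.norm_term_le hC (n + N) (s := 1) (by simp)
      simp only [norm_one, mul_one, one_re] at h
      have e : (((n + N + 1 : ℕ) : ℝ)) = (n : ℝ) + N + 1 := by push_cast; ring
      rw [e, show θ - 1 - 1 = θ - 2 by ring] at h
      exact h
    have hs2 : Summable fun n : ℕ ↦ C * (((n : ℝ) + N + 1) ^ (θ - 2)) := by
      refine Summable.mul_left C ?_
      have h := (Real.summable_nat_rpow.2 (by linarith : θ - 2 < -1)).comp_injective
        (add_left_injective (N + 1))
      refine h.congr fun n ↦ ?_
      simp only [Function.comp_apply]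
      push_cast
      ring_nf
    calc ‖∑' n : ℕ, MertensDictionary.term (n + N) 1‖
        ≤ ∑' n : ℕ, ‖MertensDictionary.term (n + N) 1‖ := norm_tsum_le_tsum_norm
          ((summable_nat_add_iff N).2 hsumm).norm
      _ ≤ ∑' n : ℕ, C * (((n : ℝ) + N + 1) ^ (θ - 2)) :=
          Summable.tsum_le_tsum hnle ((summable_nat_add_iff N).2 hsumm).norm hs2
      _ = C * ∑' n : ℕ, ((n : ℝ) + N + 1) ^ (θ - 2) := tsum_mul_left
      _ ≤ C * ((N : ℝ) ^ (θ - 2 + 1) / (-(θ - 2 + 1))) := by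
          gcongr
          exact tsum_rpow_shift_le hN (by linarith)
      _ = C / (1 - θ) * (N : ℝ) ^ (θ - 1) := by
          rw [show θ - 2 + 1 = θ - 1 by ring, show -(θ - 1) = 1 - θ by ring]
          field_simp
  -- boundary term bound
  have hbdry : ‖(mertensFunction (N : ℝ) : ℂ) * ((N + 1 : ℕ) : ℂ) ^ (-(1 : ℂ))‖ ≤ C * (N : ℝ) ^ (θ - 1) := by
    rw [cpow_neg_one, norm_mul, norm_inv, Complex.norm_natCast, Complex.norm_intCast]
    have h1 := hC N hN
    have hN1 : (N : ℝ) ≤ ((N + 1 : ℕ) : ℝ) := by push_cast; linarith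
    calc |((mertensFunction (N : ℝ) : ℤ) : ℝ)| * (((N + 1 : ℕ) : ℝ))⁻¹
        ≤ C * (N : ℝ) ^ θ * ((N : ℝ))⁻¹ := by
          gcongr
      _ = C * (N : ℝ) ^ (θ - 1) := by
          rw [Real.rpow_sub_one hN0.ne']; ring
  -- assemble
  have key : ((∑ j ∈ range (N + 1), ((ArithmeticFunction.moebius j : ℤ) : ℝ) / j : ℝ) : ℂ) =
      (mertensFunction (N : ℝ) : ℂ) * ((N + 1 : ℕ) : ℂ) ^ (-(1 : ℂ)) +
        -∑' n : ℕ, MertensDictionary.term (n + N) 1 := by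
    rw [← hreal, habel, htail]
  have hnorm := congrArg (fun z : ℂ ↦ ‖z‖) key
  simp only [Complex.norm_real, Real.norm_eq_abs] at hnorm
  rw [hnorm]
  have hexp : (N : ℝ) ^ (θ - 1) = (N : ℝ) ^ (-(1 / 2 : ℝ) + ε) := by rw [hθ]; ring_nf
  calc ‖(mertensFunction (N : ℝ) : ℂ) * ((N + 1 : ℕ) : ℂ) ^ (-(1 : ℂ)) +
        -∑' n : ℕ, MertensDictionary.term (n + N) 1‖
      ≤ ‖(mertensFunction (N : ℝ) : ℂ) * ((N + 1 : ℕ) : ℂ) ^ (-(1 : ℂ))‖ +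
        ‖-∑' n : ℕ, MertensDictionary.term (n + N) 1‖ := norm_add_le _ _
    _ ≤ C * (N : ℝ) ^ (θ - 1) + C / (1 - θ) * (N : ℝ) ^ (θ - 1) := by
        rw [norm_neg]; exact add_le_add hbdry htailb
    _ = (C + C / (1 - θ)) * (N : ℝ) ^ (-(1 / 2 : ℝ) + ε) := by rw [← hexp]; ring

/-! ## §2 The Hardy–Littlewood weight `t ↦ e^{−x/t²} − 1` -/

/-- `y e^{−y} ≤ 2 y^b` for `y > 0`, `−1 ≤ b ≤ 1` (`y^{1−b} e^{−y} ≤ 2`, `rpow_mul_exp_neg_le_two` road: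
`y ≤ 1`: `y^{1−b} ≤ 1`; `y ≥ 1`: `y^{1−b} ≤ y² ≤ 2e^y`). [cite: HardyLittlewood1916, §2.5 (elementary estimate of the kernel e^{−y} of (2.541))] -/
theorem mul_exp_neg_le_two_mul_rpow {y b : ℝ} (hy : 0 < y) (hb0 : -1 ≤ b) (hb1 : b ≤ 1) :
    y * Real.exp (-y) ≤ 2 * y ^ b := by
  have hyb : 0 < y ^ b := Real.rpow_pos_of_pos hy b
  -- `y^{1-b} e^{-y} ≤ 2`
  have hmain : y ^ (1 - b) * Real.exp (-y) ≤ 2 := by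
    have he : Real.exp (-y) ≤ 1 := Real.exp_le_one_iff.2 (by linarith)
    rcases le_or_gt y 1 with hy1 | hy1
    · have h1 : y ^ (1 - b) ≤ 1 := Real.rpow_le_one hy.le hy1 (by linarith)
      calc y ^ (1 - b) * Real.exp (-y) ≤ 1 * 1 := by gcongr
        _ ≤ 2 := by norm_num
    · have h1 : y ^ (1 - b) ≤ y ^ (2 : ℝ) := Real.rpow_le_rpow_of_exponent_le hy1.le (by linarith)
      rw [Real.rpow_two] at h1
      have h2 : y ^ 2 * Real.exp (-y) ≤ 2 := by
        have h := Real.pow_div_factorial_le_exp y hy.le 2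
        norm_num [Nat.factorial] at h
        rw [Real.exp_neg, ← div_eq_mul_inv, div_le_iff₀ (Real.exp_pos y)]
        linarith
      calc y ^ (1 - b) * Real.exp (-y) ≤ y ^ 2 * Real.exp (-y) := by gcongr
        _ ≤ 2 := h2
  calc y * Real.exp (-y) = y ^ b * (y ^ (1 - b) * Real.exp (-y)) := by
        rw [← mul_assoc, ← Real.rpow_add hy, show b + (1 - b) = 1 by ring, Real.rpow_one]
    _ ≤ y ^ b * 2 := by gcongr
    _ = 2 * y ^ b := mul_comm _ _

/-- Derivative of the Hardy–Littlewood weight `t ↦ e^{−x/t²} − 1` at `t ≠ 0`: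
`e^{−x/t²} · (2x/t³)`. [cite: HardyLittlewood1916, §2.5 (the kernel e^{−y} − 1 of (2.541), summation by parts)] -/
theorem hasDerivAt_hlWeight (x : ℝ) {t : ℝ} (ht : t ≠ 0) :
    HasDerivAt (fun t : ℝ ↦ Real.exp (-(x / t ^ 2)) - 1)
      (Real.exp (-(x / t ^ 2)) * (2 * x / t ^ 3)) t := by
  have hu : HasDerivAt (fun t : ℝ ↦ -(x / t ^ 2)) (2 * x / t ^ 3) t := by
    have h := (((hasDerivAt_pow 2 t).inv (pow_ne_zero 2 ht)).const_mul x).neg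
    have e : -(x * (-(↑(2 : ℕ) * t ^ (2 - 1)) / (t ^ 2) ^ 2)) = 2 * x / t ^ 3 := by
      field_simp
      ring
    rw [e] at h
    refine h.congr_of_eventuallyEq (Eventually.of_forall fun s ↦ ?_)
    simp [div_eq_mul_inv]
  have h := hu.exp.sub_const 1
  simpa using h

/-- The mean-value step: for `x > 0`, `−1 ≤ b ≤ 1` with `−1 − 2b ≤ 0`, and `n ≥ 1`,
`|w(n+1) − w(n)| ≤ 4 x^b n^{−1−2b}`, `w(t) = e^{−x/t²} − 1` (on `[n, n+1]`,
`|w'(t)| = (2/t)·y e^{−y} ≤ 4y^b/t = 4 x^b t^{−1−2b}`, `y = x/t²`).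
[cite: HardyLittlewood1916, §2.5 (summation by parts, estimate of the weight); BaezDuarte2005 §3] -/
theorem abs_hlWeight_sub_le {x b : ℝ} (hx : 0 < x) (hb0 : -1 ≤ b) (hb1 : b ≤ 1)
    (hb2 : -1 - 2 * b ≤ 0) {n : ℕ} (hn : 1 ≤ n) :
    |(Real.exp (-(x / ((n : ℝ) + 1) ^ 2)) - 1) - (Real.exp (-(x / (n : ℝ) ^ 2)) - 1)| ≤
      4 * x ^ b * (n : ℝ) ^ (-1 - 2 * b) := by
  have hn0 : (0 : ℝ) < n := by exact_mod_cast hn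
  set g : ℝ → ℝ := fun t ↦ Real.exp (-(x / t ^ 2)) - 1 with hg
  set g' : ℝ → ℝ := fun t ↦ Real.exp (-(x / t ^ 2)) * (2 * x / t ^ 3) with hg'
  have hderiv : ∀ t ∈ Set.Icc (n : ℝ) (n + 1), HasDerivWithinAt g (g' t) (Set.Icc (n : ℝ) (n + 1)) t :=
    fun t ht ↦ (hasDerivAt_hlWeight x (by linarith [ht.1] : t ≠ 0)).hasDerivWithinAt
  have hbound : ∀ t ∈ Set.Icc (n : ℝ) (n + 1), ‖g' t‖ ≤ 4 * x ^ b * (n : ℝ) ^ (-1 - 2 * b) := by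
    intro t ht
    have ht0 : 0 < t := by linarith [ht.1]
    have ht3 : 0 < t ^ 3 := by positivity
    set y : ℝ := x / t ^ 2 with hy
    have hy0 : 0 < y := by positivity
    have hnorm : ‖g' t‖ = 2 / t * (y * Real.exp (-y)) := by
      simp only [hg', Real.norm_eq_abs, abs_mul, Real.abs_exp, abs_div, abs_of_pos ht3,
        abs_of_pos (by positivity : (0 : ℝ) < 2 * x)]
      rw [hy]
      field_simp
    rw [hnorm]
    have hkey := mul_exp_neg_le_two_mul_rpow hy0 hb0 hb1
    have hyb : y ^ b = x ^ b * t ^ (-(2 * b)) := by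
      rw [hy, Real.div_rpow hx.le (by positivity), Real.rpow_neg ht0.le, ← Real.rpow_natCast,
        ← Real.rpow_mul ht0.le]
      norm_num
      rw [div_eq_mul_inv]
    have htn : t ^ (-1 - 2 * b) ≤ (n : ℝ) ^ (-1 - 2 * b) :=
      Real.rpow_le_rpow_of_nonpos hn0 ht.1 hb2
    calc 2 / t * (y * Real.exp (-y)) ≤ 2 / t * (2 * y ^ b) := by gcongr
      _ = 4 * x ^ b * (t ^ (-(2 * b)) * t ^ (-1 : ℝ)) := by
          rw [hyb, Real.rpow_neg_one]; ring
      _ = 4 * x ^ b * t ^ (-1 - 2 * b) := by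
          rw [← Real.rpow_add ht0]; ring_nf
      _ ≤ 4 * x ^ b * (n : ℝ) ^ (-1 - 2 * b) := by gcongr
  have hmvt := Convex.norm_image_sub_le_of_norm_hasDerivWithin_le hderiv hbound (convex_Icc _ _)
    (Set.left_mem_Icc.2 (by linarith)) (Set.right_mem_Icc.2 (by linarith))
  rw [Real.norm_eq_abs, Real.norm_eq_abs, show ((n : ℝ) + 1 - n) = 1 by ring, abs_one, mul_one] at hmvt
  simpa [hg] using hmvt

/-! ## §3 Hardy–Littlewood's criterion, direction "⟹", and the discharge -/

/-- **RH ⟹ `Σ_{k≥1} (−x)^k/(k! ζ(2k+1)) = O(x^{−1/4+δ})`** (Hardy–Littlewood 1916 §2.5: "the result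
thus suggested is in fact true"; Titchmarsh (14.32.3)), PROVED by summation by parts of
`H(x) = Σ (e^{−x/n²} − 1)(μ(n)/n)` against `g(n) = Σ_{j≤n} μ(j)/j ≪ n^{−1/2+δ}`.
[cite: HardyLittlewood1916, §2.5 eq. (2.545) (necessity); BaezDuarte2005Moebius (3.7)] -/
theorem hardyLittlewoodFunction_isBigO_of_riemannHypothesis (hRH : RiemannHypothesis) {δ : ℝ}
    (hδ : 0 < δ) :
    hardyLittlewoodFunction =O[atTop] fun x : ℝ ↦ x ^ (-(1 / 4 : ℝ) + δ) := by
  -- reduce to `δ ≤ 1/4`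
  wlog hδ1 : δ ≤ 1 / 4 generalizing δ with H
  · have h1 := H (δ := 1 / 4) (by norm_num) le_rfl
    refine h1.trans (IsBigO.of_bound 1 ?_)
    filter_upwards [eventually_ge_atTop (1 : ℝ)] with x hx
    rw [one_mul, Real.norm_of_nonneg (by positivity), Real.norm_of_nonneg (by positivity)]
    exact Real.rpow_le_rpow_of_exponent_le hx (by linarith)
  set b : ℝ := -(1 / 4) + δ with hb
  have hb0 : -1 ≤ b := by rw [hb]; linarith
  have hb1 : b ≤ 1 := by rw [hb]; linarith
  have hb2 : -1 - 2 * b ≤ 0 := by rw [hb]; linarith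
  -- Littlewood's bound `|g(n)| ≤ C' n^{-1/2+δ}`
  obtain ⟨C', hC'0, hC'⟩ := abs_sum_moebius_div_le_of_riemannHypothesis hRH hδ (by linarith)
  -- dominating series
  have hZs : Summable fun n : ℕ ↦ (n : ℝ) ^ (-1 - δ) := Real.summable_nat_rpow.2 (by linarith)
  set Z : ℝ := ∑' n : ℕ, (n : ℝ) ^ (-1 - δ) with hZ
  have hZ0 : 0 ≤ Z := tsum_nonneg fun n ↦ Real.rpow_nonneg (Nat.cast_nonneg n) _
  refine IsBigO.of_bound (4 * C' * Z) ?_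
  filter_upwards [eventually_ge_atTop (1 : ℝ)] with x hx
  have hx0 : 0 < x := by linarith
  -- weight and coefficients
  set f : ℕ → ℝ := fun n ↦ Real.exp (-(x / (n : ℝ) ^ 2)) - 1 with hf
  set c : ℕ → ℝ := fun n ↦ ((ArithmeticFunction.moebius n : ℤ) : ℝ) / n with hc
  have hc1 : ∀ n : ℕ, |c n| ≤ 1 := fun n ↦ by
    simp only [hc]
    rcases Nat.eq_zero_or_pos n with rfl | hn
    · simp
    · rw [abs_div, Nat.abs_cast]
      have hμ : |((ArithmeticFunction.moebius n : ℤ) : ℝ)| ≤ 1 := by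
        exact_mod_cast ArithmeticFunction.abs_moebius_le_one
      have hn1 : (1 : ℝ) ≤ n := by exact_mod_cast hn
      exact (div_le_one (by linarith)).2 (hμ.trans hn1)
  have hfabs : ∀ n : ℕ, 1 ≤ n → |f n| ≤ x / (n : ℝ) ^ 2 := fun n hn ↦ by
    have hy : 0 ≤ x / (n : ℝ) ^ 2 := by positivity
    have h1 : Real.exp (-(x / (n : ℝ) ^ 2)) ≤ 1 := Real.exp_le_one_iff.2 (by linarith)
    have h2 : -(x / (n : ℝ) ^ 2) + 1 ≤ Real.exp (-(x / (n : ℝ) ^ 2)) := Real.add_one_le_exp _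
    simp only [hf]
    rw [abs_of_nonpos (by linarith)]
    linarith
  -- (a) `H(x) = Σ f(n) c(n)` and summability
  have hsumm : Summable fun n ↦ f n * c n := by
    refine Summable.of_norm_bounded (g := fun n : ℕ ↦ x * (1 / (n : ℝ) ^ 2))
      ((Real.summable_one_div_nat_pow.2 one_lt_two).mul_left x) fun n ↦ ?_
    rw [Real.norm_eq_abs, abs_mul]
    rcases Nat.eq_zero_or_pos n with rfl | hn
    · simp [hc]
    · have hx2 : 0 ≤ x / (n : ℝ) ^ 2 := by positivity
      calc |f n| * |c n| ≤ x / (n : ℝ) ^ 2 * 1 :=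
            mul_le_mul (hfabs n hn) (hc1 n) (abs_nonneg _) hx2
        _ = x * (1 / (n : ℝ) ^ 2) := by ring
  have hF : hardyLittlewoodFunction x = ∑' n, f n * c n := by
    have h := hardyLittlewoodFunction_eq_tsum_moebius x
    have h2 : ((∑' n, f n * c n : ℝ) : ℂ) = ∑' n : ℕ, ((ArithmeticFunction.moebius n : ℤ) : ℂ) *
        ((((Real.exp (-(x / (n : ℝ) ^ 2)) - 1) / n : ℝ) : ℂ)) := by
      rw [Complex.ofReal_tsum]
      refine tsum_congr fun n ↦ ?_
      simp only [hf, hc]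
      push_cast
      ring
    exact_mod_cast h.trans h2.symm
  -- (b) boundary terms `f(n) g(n) → 0` (`|f(n)| ≤ x/n²`, `|g(n)| ≤ n + 1`)
  have h0 : Tendsto (fun n : ℕ ↦ f n * ∑ j ∈ range (n + 1), c j) atTop (𝓝 0) := by
    have hlim : Tendsto (fun n : ℕ ↦ 2 * x / (n : ℝ)) atTop (𝓝 0) :=
      tendsto_const_div_atTop_nhds_zero_nat (2 * x)
    refine squeeze_zero_norm' ?_ hlim
    filter_upwards [eventually_ge_atTop 1] with n hn
    have hn0 : (0 : ℝ) < n := by exact_mod_cast hn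
    have hn1 : (1 : ℝ) ≤ n := by exact_mod_cast hn
    rw [Real.norm_eq_abs, abs_mul]
    have hS : |∑ j ∈ range (n + 1), c j| ≤ (n : ℝ) + 1 := by
      calc |∑ j ∈ range (n + 1), c j| ≤ ∑ j ∈ range (n + 1), |c j| := Finset.abs_sum_le_sum_abs _ _
        _ ≤ ∑ j ∈ range (n + 1), (1 : ℝ) := Finset.sum_le_sum fun j _ ↦ hc1 j
        _ = (n : ℝ) + 1 := by simp
    have hx2 : 0 ≤ x / (n : ℝ) ^ 2 := by positivity
    calc |f n| * |∑ j ∈ range (n + 1), c j| ≤ x / (n : ℝ) ^ 2 * ((n : ℝ) + 1) :=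
          mul_le_mul (hfabs n hn) hS (abs_nonneg _) hx2
      _ ≤ x / (n : ℝ) ^ 2 * (2 * n) := by gcongr; linarith
      _ = 2 * x / n := by field_simp
  -- (c) the dominated summed-by-parts series
  have hB : ∀ N : ℕ, ∑ i ∈ range N, |f (i + 1) - f i| * |∑ j ∈ range (i + 1), c j| ≤
      4 * C' * Z * x ^ b := by
    intro N
    have hterm : ∀ i ∈ range N, |f (i + 1) - f i| * |∑ j ∈ range (i + 1), c j| ≤
        4 * C' * x ^ b * (i : ℝ) ^ (-1 - δ) := by
      intro i _
      rcases Nat.eq_zero_or_pos i with rfl | hi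
      · simp [hc, Real.zero_rpow (show (-1 - δ : ℝ) ≠ 0 by linarith)]
      have hi0 : (0 : ℝ) < i := by exact_mod_cast hi
      have h1 : |f (i + 1) - f i| ≤ 4 * x ^ b * (i : ℝ) ^ (-1 - 2 * b) := by
        have := abs_hlWeight_sub_le hx0 hb0 hb1 hb2 (n := i) hi
        simpa [hf, Nat.cast_add, Nat.cast_one] using this
      have h2 : |∑ j ∈ range (i + 1), c j| ≤ C' * (i : ℝ) ^ (-(1 / 2 : ℝ) + δ) := hC' i hi
      calc |f (i + 1) - f i| * |∑ j ∈ range (i + 1), c j|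
          ≤ (4 * x ^ b * (i : ℝ) ^ (-1 - 2 * b)) * (C' * (i : ℝ) ^ (-(1 / 2 : ℝ) + δ)) :=
            mul_le_mul h1 h2 (abs_nonneg _) (by positivity)
        _ = 4 * C' * x ^ b * ((i : ℝ) ^ (-1 - 2 * b) * (i : ℝ) ^ (-(1 / 2 : ℝ) + δ)) := by ring
        _ = 4 * C' * x ^ b * (i : ℝ) ^ (-1 - δ) := by
            rw [← Real.rpow_add hi0]; congr 1; rw [hb]; ring_nf
    calc ∑ i ∈ range N, |f (i + 1) - f i| * |∑ j ∈ range (i + 1), c j|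
        ≤ ∑ i ∈ range N, 4 * C' * x ^ b * (i : ℝ) ^ (-1 - δ) := Finset.sum_le_sum hterm
      _ = 4 * C' * x ^ b * ∑ i ∈ range N, (i : ℝ) ^ (-1 - δ) := by rw [Finset.mul_sum]
      _ ≤ 4 * C' * x ^ b * Z := by
          gcongr
          exact hZs.sum_le_tsum (range N) fun i _ ↦ Real.rpow_nonneg (Nat.cast_nonneg i) _
      _ = 4 * C' * Z * x ^ b := by ring
  -- (d) assemble
  have hmain := abs_tsum_mul_le_of_abel hsumm h0 hB
  rw [← hF] at hmain
  rw [Real.norm_eq_abs, Real.norm_of_nonneg (Real.rpow_nonneg hx0.le _)]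
  exact hmain

/-- The same in the shape of the named fact: the left-hand side of `HardyLittlewood1916_criterion`
implies its right-hand side. [cite: HardyLittlewood1916, §2.5 eq. (2.545) (necessity)] -/
theorem HardyLittlewood1916_criterion.mp_holds :
    RiemannHypothesis → ∀ δ : ℝ, 0 < δ →
      hardyLittlewoodFunction =O[atTop] fun x : ℝ ↦ x ^ (-(1 / 4 : ℝ) + δ) :=
  fun hRH _ hδ ↦ hardyLittlewoodFunction_isBigO_of_riemannHypothesis hRH hδ

/-- **DISCHARGE of the named fact `HardyLittlewood1916_criterion`** (= Broughan Vol. 2 Thm 2.5;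
Hardy–Littlewood, Acta Math. 41, §2.5 (2.545): the estimate `O(x^{−1/4+δ})` for all `δ > 0` "is a
necessary and sufficient condition for the truth of the Riemann hypothesis"):
`RiemannHypothesis ↔ ∀ δ > 0, Σ_{k≥1} (−x)^k/(k! ζ(2k+1)) = O(x^{−1/4+δ})` is a THEOREM of the tree
— necessity by this file, sufficiency by `HardyLittlewood1916_criterion.mpr_holds`
(`HardyLittlewoodCriterionProofs`). An equivalence is proved; neither side is asserted.
[cite: HardyLittlewood1916, §2.5 eq. (2.545) p. 161; Titchmarsh1986 §14.32 (14.32.3); Broughan2017 Vol. 2 Thm 2.5] -/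
theorem HardyLittlewood1916_criterion_holds : HardyLittlewood1916_criterion :=
  ⟨HardyLittlewood1916_criterion.mp_holds, HardyLittlewood1916_criterion.mpr_holds⟩

end Literature.NumberTheory.LFunctions

end
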